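import Summits.ResolutionOfSingularities.ResolutionOfSingularities.Theorems.FrobeniusLadderFInjectiveMacaulayficationFDStorey1Fan
import Summits.ResolutionOfSingularities.ResolutionOfSingularities.Theorems.FrobeniusLadderFInjectiveMacaulayficationFDSpecimen
import Summits.ResolutionOfSingularities.ResolutionOfSingularities.Theorems.FrobeniusLadderFInjectiveMacaulayficationMonomialChartPresentationPrime
import Summits.ResolutionOfSingularities.ResolutionOfSingularities.Theorems.FrobeniusLadderFInjectiveMacaulayficationBlowupFiModelOfCover
import Summits.ResolutionOfSingularities.ResolutionOfSingularities.Theorems.FrobeniusLadderFInjectiveMacaulayficationReesChartRing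
import Summits.ResolutionOfSingularities.ResolutionOfSingularities.Theorems.FrobeniusLadderFInjectiveMacaulayficationCIConeFiModelCore
import Summits.ResolutionOfSingularities.ResolutionOfSingularities.Theorems.FrobeniusLadderFInjectiveMacaulayficationReesCoverOfPowers
import Summits.ResolutionOfSingularities.ResolutionOfSingularities.Theorems.FrobeniusLadderFInjectiveMacaulayficationClauseOfMaximal
import Summits.ResolutionOfSingularities.ResolutionOfSingularities.Theorems.FrobeniusLadderFInjectiveMacaulayficationFTemkinClosedPoints
import Literature.AlgebraicGeometry.Resolution.AffineBlowupCartier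
import HarnessLib

/-!
# BED D STOREY 1 — THE CHART PACKAGE: every point of `Bl_{𝔪·K} X_D` lies in a Rees chart `D₊(x̄^{m_c} t)`, every chart ring is the POLYNOMIAL MODEL `k[Y]/(g_c)`
# (explicit ring isomorphism compatible with the structure maps), and FULL at a point follows from the model clause at a maximal ideal above it
# (crux `FInjectiveMacaulayfication` stmt-ResolutionOfSingularities-15315, chain w45a; (W-TD) BED D storey 1 (D-1), res-L1-w45a-plan-1 R21.18 (4); seat res-L1-w45a-stub-2 g10)

Support file for crux stmt-ResolutionOfSingularities-15315 (`FrobeniusLadder.FInjectiveMacaulayfication`), chain w45a.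
[OURS · L1 W4.5a] — NOT a statement of any manuscript; AI-written, weaker than expert review.

`R̄ = k[x,y,u,t,z]/(f_D)`, `f_D = z⁴+x⁵z+x⁶+y³+u³+t⁷`, char 2 (res-L1-w45a-stub-3's `FDSpecimen`); `I_A = span (x̄^A)` the certified monomial centre (`= 𝔪·K`,
`FDStorey1Fan.span_A_eq_floor_mul_K`); `X₁ = affineBlowup I_A`; `u_c = x̄^{m_c}` the chart vertices.
* §1 (generic) `fullCl_stalk_chartι_of_model_clause` — for ANY Noetherian domain `R` of characteristic `p`, `u ∈ I`, `u ≠ 0`, a ring isomorphism `σ` from the Rees chart ring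
  `(R[It])_{(ut)}` to a Noetherian model `B` of characteristic `p`, a point `q₀` of the chart and a maximal `Q' ⊇ σ(q₀)` of `B` where the FULL clause holds: FULL at the stalk of
  `affineBlowup I` at `chartι u q₀` (descent `ClauseOfMaximal.fiClause_atPrime_of_le` + the stalk/localisation isomorphisms);
  `comap_asIdeal_π_chartι` — `(π (chartι u q₀)) = reesChartBase⁻¹ q₀`.
* §2 (BED D) `exists_chart` — every point of `X₁` lies in some `D₊(u_c t)` (`ReesCoverOfPowers` on `FDStorey1Fan.hcov`); `exists_modelEquiv` — for every chart `c` a ring isomorphism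
  `σ_c : (R̄[I_A t])_{(u_c t)} ≃+* k[Y]/(g_c)` with `σ_c (x̄-structure map q) = θ_c q mod g_c` (res-L1-w45a-stub-1's (C1) `MonomialChartPresentationPrime` + Literature `reesChartEquiv`);
  `mk_theta_X_mem_of_over_vertex` — over the vertex, the `θ_c(x_j)` lie in the model prime.
No definitions, no named facts. [folklore; cite: StacksProject, Tag 0804; GortzWedhorn2020, Prop. 13.91]
-/

-- single-problem summit: the doubled namespace component is forced
set_option linter.dupNamespace false

noncomputable section

namespace Summit.ResolutionOfSingularities.ResolutionOfSingularities.Theorems.FInjectiveMacaulayfication.FDStorey1Charts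

open AlgebraicGeometry CategoryTheory Literature.AlgebraicGeometry.Resolution TopologicalSpace IsLocalRing MvPolynomial
open Summit.ResolutionOfSingularities.ResolutionOfSingularities.Theorems.FInjectiveMacaulayfication
open SliceableCentre FanCheckKit FanCheckSound FDStorey1Fan

/-! ## §1 Generic: FULL at a chart point from the model clause; the structure map on chart points -/

/-- **`π` on a chart point**: `(π (chartι u q₀)).asIdeal = q₀.asIdeal.comap (reesChartBase u)`. [cite: StacksProject, Tag 0804] -/
theorem comap_asIdeal_π_chartι {R : Type} [CommRing R] {I : Ideal R} (u : R) (hu : u ∈ I)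
    (q₀ : PrimeSpectrum (HomogeneousLocalization.Away (reesGrading I) (reesT u hu))) :
    ((affineBlowup.π I).base ((affineBlowup.chartι (I := I) u hu).base q₀)).asIdeal = q₀.asIdeal.comap (reesChartBase (I := I) u hu) := by
  rw [← Scheme.Hom.comp_apply, affineBlowup.chartι_π u hu, Spec.map_apply]
  rfl

set_option maxHeartbeats 800000 in
-- stalk / localisation isomorphisms of the Rees chart elaborate slowly
/-- **FULL AT A CHART POINT FROM THE MODEL CLAUSE.** `R` a Noetherian domain of characteristic `p`, `u ∈ I`; `σ` a ring isomorphism from the Rees chart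
ring `(R[It])_{(ut)}` to a Noetherian ring `B` of characteristic `p`; `q₀` a point of the chart and `Q'` a maximal ideal of `B` containing `σ(q₀)` at which FULL holds. Then the
stalk of `affineBlowup I` at `chartι u q₀` is FULL: descend the clause from `Q'` to the prime `σ(q₀)` (Hashimoto, `ClauseOfMaximal.fiClause_atPrime_of_le`), move along
`B_{σ(q₀)} ≅ ((R[It])_{(ut)})_{q₀} ≅ 𝒪_{Bl, chartι u q₀}`. [cite: StacksProject, Tag 0804; GortzWedhorn2020, Prop. 13.91] -/
theorem fullCl_stalk_chartι_of_model_clause (p : ℕ) [Fact p.Prime] {R : Type} [CommRing R] [IsDomain R] [IsNoetherianRing R] [CharP R p]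
    {I : Ideal R} (u : R) (hu : u ∈ I) {B : Type} [CommRing B] [IsNoetherianRing B] [CharP B p]
    (σ : HomogeneousLocalization.Away (reesGrading I) (reesT u hu) ≃+* B)
    (q₀ : PrimeSpectrum (HomogeneousLocalization.Away (reesGrading I) (reesT u hu))) (Q' : Ideal B) [Q'.IsMaximal]
    (hle : q₀.asIdeal.map (σ : HomogeneousLocalization.Away (reesGrading I) (reesT u hu) →+* B) ≤ Q') (hQ' : FullCl p (Localization.AtPrime Q')) :
    FullCl p ((affineBlowup I).presheaf.stalk ((affineBlowup.chartι (I := I) u hu).base q₀)) := by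
  -- the prime `q := σ(q₀)` of `B`
  set q : Ideal B := q₀.asIdeal.map (σ : HomogeneousLocalization.Away (reesGrading I) (reesT u hu) →+* B) with hq
  have hqc : q = q₀.asIdeal.comap (σ.symm : B →+* HomogeneousLocalization.Away (reesGrading I) (reesT u hu)) := by
    rw [hq, Ideal.map_comap_of_equiv]
    rfl
  haveI hqp : q.IsPrime := by rw [hqc]; exact Ideal.comap_isPrime _ _
  -- descend the clause to `q`
  have hqcl := ClauseOfMaximal.fiClause_atPrime_of_le p (P := q) (Q := Q') hle hQ'
  -- `B_q ≅ ((R[It])_{(ut)})_{q₀}`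
  obtain ⟨e₁⟩ := BlowupFiModelOfCover.nonempty_ringEquiv_localization_of_ringEquiv σ.symm q q₀.asIdeal (fun x => by
    rw [hqc, Ideal.mem_comap]; rfl)
  -- `((R[It])_{(ut)})_{q₀} ≅ 𝒪_{Bl, chartι u q₀}`
  let e₂ : ((affineBlowup I).presheaf.stalk ((affineBlowup.chartι (I := I) u hu).base q₀)) ≃+* Localization.AtPrime q₀.asIdeal :=
    (asIso ((affineBlowup.chartι (I := I) u hu).stalkMap q₀)).commRingCatIsoToRingEquiv.trans
      (Spec.stalkIso (.of (HomogeneousLocalization.Away (reesGrading I) (reesT u hu))) q₀).commRingCatIsoToRingEquiv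
  exact WFixAtNonClosedDimTwo.fullCl_of_ringEquiv p (e₁.trans e₂.symm) hqcl

/-! ## §2 BED D: the cover, the models, the centre -/

section BedD

variable (k : Type) [Field k]

/-- The chart vertices `x̄^{m_c}` lie in the centre `I_A`. [plumbing] -/
theorem mk_vertex_mem (f : MvPolynomial (Fin 5) k) (c : Fin 327) :
    Ideal.Quotient.mk (Ideal.span {f}) (monomial (chartM 5 AL2 CL 327 c) (1 : k)) ∈
      Ideal.span ((fun e : Fin 5 →₀ ℕ => Ideal.Quotient.mk (Ideal.span {f}) (monomial e (1 : k))) '' (genSet 5 AL2 : Set (Fin 5 →₀ ℕ))) :=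
  Ideal.subset_span ⟨_, Finset.mem_coe.mpr (FDStorey1Fan.hm c), rfl⟩

/-- No variable vanishes in `R̄` and `(f)` is prime (res-L1-w45a-stub-3's `FDSpecimen`), restated. [plumbing] -/
theorem isPrime_and_mk_X_ne_zero [CharP k 2] (f : MvPolynomial (Fin 5) k) (hf : f = X 4 ^ 4 + X 0 ^ 5 * X 4 + X 0 ^ 6 + X 1 ^ 3 + X 2 ^ 3 + X 3 ^ 7) :
    (Ideal.span {f}).IsPrime ∧ ∀ i : Fin 5, Ideal.Quotient.mk (Ideal.span {f}) (X i) ≠ 0 :=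
  ⟨FDSpecimen.isPrime_span_f k f hf, FDSpecimen.mk_X_ne_zero k f hf⟩

/-- The chart vertices are non-zero in the domain `R̄`. [plumbing] -/
theorem mk_vertex_ne_zero [CharP k 2] (f : MvPolynomial (Fin 5) k) (hf : f = X 4 ^ 4 + X 0 ^ 5 * X 4 + X 0 ^ 6 + X 1 ^ 3 + X 2 ^ 3 + X 3 ^ 7) (c : Fin 327) :
    Ideal.Quotient.mk (Ideal.span {f}) (monomial (chartM 5 AL2 CL 327 c) (1 : k)) ≠ 0 :=
  haveI := (isPrime_and_mk_X_ne_zero k f hf).1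
  CIConeFiModelCore.mk_monomial_ne_zero (Ideal.span {f}) (isPrime_and_mk_X_ne_zero k f hf).2 _

set_option maxHeartbeats 400000 in
/-- ★ **EVERY POINT OF `X₁ = Bl_{I_A} X_D` LIES IN A REES CHART `D₊(x̄^{m_c} t)`** — the radical cover inequality from the certified cover records (`FDStorey1Fan.hcov` via
res-L1-w45a-stub-1's `ReesCoverOfPowers`), then `BlowupFiModelOfCover.exists_mem_basicOpen_of_irrelevant_le_radical`. [cite: StacksProject, Tag 0804] -/
theorem exists_chart (f : MvPolynomial (Fin 5) k)
    (y : ↥(affineBlowup (Ideal.span ((fun e : Fin 5 →₀ ℕ => Ideal.Quotient.mk (Ideal.span {f}) (monomial e (1 : k))) '' (genSet 5 AL2 : Set (Fin 5 →₀ ℕ)))))) :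
    ∃ (c : Fin 327) (q₀ : PrimeSpectrum (HomogeneousLocalization.Away
        (reesGrading (Ideal.span ((fun e : Fin 5 →₀ ℕ => Ideal.Quotient.mk (Ideal.span {f}) (monomial e (1 : k))) '' (genSet 5 AL2 : Set (Fin 5 →₀ ℕ)))))
        (reesT (Ideal.Quotient.mk (Ideal.span {f}) (monomial (chartM 5 AL2 CL 327 c) (1 : k))) (mk_vertex_mem k f c)))),
      (affineBlowup.chartι (Ideal.Quotient.mk (Ideal.span {f}) (monomial (chartM 5 AL2 CL 327 c) (1 : k))) (mk_vertex_mem k f c)).base q₀ = y := by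
  classical
  -- THE COVER INEQUALITY, read off the identities `(x^a)^K = x^(m c) · y`
  have hImap : Ideal.span ((fun e : Fin 5 →₀ ℕ => Ideal.Quotient.mk (Ideal.span {f}) (monomial e (1 : k))) '' (genSet 5 AL2 : Set (Fin 5 →₀ ℕ))) =
      (Ideal.span ((fun b : Fin 5 →₀ ℕ => (monomial b (1 : k) : MvPolynomial (Fin 5) k)) '' (genSet 5 AL2 : Set (Fin 5 →₀ ℕ)))).map
        (Ideal.Quotient.mk (Ideal.span {f})) := by
    rw [Ideal.map_span, Set.image_image]
  have hcovR : (HomogeneousIdeal.irrelevant (reesGrading (Ideal.span ((fun e : Fin 5 →₀ ℕ => Ideal.Quotient.mk (Ideal.span {f}) (monomial e (1 : k))) ''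
      (genSet 5 AL2 : Set (Fin 5 →₀ ℕ)))))).toIdeal ≤
      (Ideal.span (Set.range fun c : Fin 327 => reesT (I := Ideal.span ((fun e : Fin 5 →₀ ℕ => Ideal.Quotient.mk (Ideal.span {f}) (monomial e (1 : k))) ''
        (genSet 5 AL2 : Set (Fin 5 →₀ ℕ)))) (Ideal.Quotient.mk (Ideal.span {f}) (monomial (chartM 5 AL2 CL 327 c) (1 : k))) (mk_vertex_mem k f c))).radical := by
    refine ReesCoverOfPowers.stub_reesCoverOfPowers _ _ (Ideal.Quotient.mk (Ideal.span {f}) '' ((fun b : Fin 5 →₀ ℕ =>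
      (monomial b (1 : k) : MvPolynomial (Fin 5) k)) '' (genSet 5 AL2 : Set (Fin 5 →₀ ℕ)))) (by rw [hImap, Ideal.map_span]) 327 _ (mk_vertex_mem k f) ?_
    rintro _ ⟨_, ⟨a', ha', rfl⟩, rfl⟩
    obtain ⟨c, K, hK, y', hy', hEq⟩ := FDStorey1Fan.hcov k a' ha'
    refine ⟨c, K, hK, Ideal.Quotient.mk (Ideal.span {f}) y', ?_, ?_⟩
    · rw [hImap, ← Ideal.map_pow]
      exact Ideal.mem_map_of_mem _ hy'
    · rw [← map_pow, hEq, map_mul]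
  obtain ⟨c, hc⟩ := BlowupFiModelOfCover.exists_mem_basicOpen_of_irrelevant_le_radical _ (mk_vertex_mem k f) hcovR y
  rw [← Proj.opensRange_awayι (reesGrading _) (reesT _ (mk_vertex_mem k f c)) (reesT_mem _ (mk_vertex_mem k f c)) Nat.one_pos] at hc
  obtain ⟨q₀, hq₀⟩ := Scheme.Hom.mem_opensRange.mp hc
  exact ⟨c, q₀, hq₀⟩

set_option maxHeartbeats 1600000 in
-- the Rees chart ring / blow-up algebra types unify slowly
/-- ★ **THE POLYNOMIAL MODEL OF EVERY CHART**: for each chart `c` a ring isomorphism `σ_c : (R̄[I_A t])_{(x̄^{m_c} t)} ≃+* k[Y]/(g_c)` such that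
(i) `x̄^{m_c}`-chart values: `reesChartEquiv (σ_c⁻¹ (θ_c q mod g_c)) = q̄ / 1` in `R̄[1/x̄^{m_c}]` for every polynomial `q`, and hence (ii) `σ_c` carries the structure map to the chart
map: `σ_c (reesChartBase q̄) = θ_c q mod g_c`. Assembled from res-L1-w45a-stub-1's (C1) presentation `MonomialChartPresentationPrime.exists_monomialChartPresentation_of_isPrime`
(on the certified chart data `hV hgen haA hge hθF₀ hX` and `FDSpecimen`'s primality) and Literature's `reesChartEquiv`. [cite: StacksProject, Tag 0804] -/
theorem exists_modelEquiv [CharP k 2] (f : MvPolynomial (Fin 5) k) (hf : f = X 4 ^ 4 + X 0 ^ 5 * X 4 + X 0 ^ 6 + X 1 ^ 3 + X 2 ^ 3 + X 3 ^ 7) (c : Fin 327) :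
    ∃ σ : HomogeneousLocalization.Away
        (reesGrading (Ideal.span ((fun e : Fin 5 →₀ ℕ => Ideal.Quotient.mk (Ideal.span {f}) (monomial e (1 : k))) '' (genSet 5 AL2 : Set (Fin 5 →₀ ℕ)))))
        (reesT (Ideal.Quotient.mk (Ideal.span {f}) (monomial (chartM 5 AL2 CL 327 c) (1 : k))) (mk_vertex_mem k f c)) ≃+*
        (MvPolynomial (Fin 5) k ⧸ Ideal.span {KLocCellKit.evalL k (G c)}),
      (∀ q : MvPolynomial (Fin 5) k,
        ((reesChartEquiv (Ideal.Quotient.mk (Ideal.span {f}) (monomial (chartM 5 AL2 CL 327 c) (1 : k))) (mk_vertex_mem k f c))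
          (σ.symm (Ideal.Quotient.mk (Ideal.span {KLocCellKit.evalL k (G c)})
            (aeval (fun j : Fin 5 => ∏ i : Fin 5, (X i : MvPolynomial (Fin 5) k) ^ Vq c i j) q))) :
            Localization.Away (Ideal.Quotient.mk (Ideal.span {f}) (monomial (chartM 5 AL2 CL 327 c) (1 : k)))) =
          algebraMap (MvPolynomial (Fin 5) k ⧸ Ideal.span {f}) _ (Ideal.Quotient.mk (Ideal.span {f}) q)) ∧
      (∀ q : MvPolynomial (Fin 5) k,
        σ (reesChartBase (Ideal.Quotient.mk (Ideal.span {f}) (monomial (chartM 5 AL2 CL 327 c) (1 : k))) (mk_vertex_mem k f c)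
          (Ideal.Quotient.mk (Ideal.span {f}) q)) =
          Ideal.Quotient.mk (Ideal.span {KLocCellKit.evalL k (G c)}) (aeval (fun j : Fin 5 => ∏ i : Fin 5, (X i : MvPolynomial (Fin 5) k) ^ Vq c i j) q)) := by
  have hθ : aeval (fun j : Fin 5 => ∏ i : Fin 5, (X i : MvPolynomial (Fin 5) k) ^ Vq c i j) f =
      monomial (Finsupp.equivFunOnFinite.symm (dq c)) (1 : k) * KLocCellKit.evalL k (G c) := by
    rw [hf]; exact hθF₀ k c
  obtain ⟨e, hbij, he⟩ := MonomialChartPresentationPrime.exists_monomialChartPresentation_of_isPrime f (Vq c) (hV c) (chartM 5 AL2 CL 327 c)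
    (chartA 5 AL2 CL 327 c) (hgen c) (genSet 5 AL2) (haA c) (hge c) (Finsupp.equivFunOnFinite.symm (dq c)) (KLocCellKit.evalL k (G c)) hθ
    (isPrime_and_mk_X_ne_zero k f hf).1 (isPrime_and_mk_X_ne_zero k f hf).2 (hX k c)
  let ε := RingEquiv.ofBijective e hbij
  refine ⟨(reesChartEquiv _ (mk_vertex_mem k f c)).trans ε.symm, fun q => ?_, fun q => ?_⟩
  · rw [RingEquiv.symm_trans_apply, RingEquiv.symm_symm, RingEquiv.apply_symm_apply, RingEquiv.ofBijective_apply]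
    exact he q
  · rw [RingEquiv.trans_apply, reesChartEquiv_reesChartBase, RingEquiv.symm_apply_eq, RingEquiv.ofBijective_apply]
    exact Subtype.ext ((he q).trans (Subalgebra.coe_algebraMap _ _).symm).symm

set_option maxHeartbeats 400000 in
/-- **OVER THE VERTEX, THE `θ_c(x_j)` LIE IN THE MODEL PRIME**: if `y = chartι q₀` lies over a point of `X_D` containing all `x̄ⱼ`, then `θ_c(x_j) mod g_c ∈ σ_c(q₀)` for the
model isomorphism of `exists_modelEquiv` (any `σ` with property (ii)). [cite: StacksProject, Tag 0804] -/
theorem mk_theta_X_mem_of_over_vertex (f : MvPolynomial (Fin 5) k) (c : Fin 327)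
    (σ : HomogeneousLocalization.Away
        (reesGrading (Ideal.span ((fun e : Fin 5 →₀ ℕ => Ideal.Quotient.mk (Ideal.span {f}) (monomial e (1 : k))) '' (genSet 5 AL2 : Set (Fin 5 →₀ ℕ)))))
        (reesT (Ideal.Quotient.mk (Ideal.span {f}) (monomial (chartM 5 AL2 CL 327 c) (1 : k))) (mk_vertex_mem k f c)) ≃+*
        (MvPolynomial (Fin 5) k ⧸ Ideal.span {KLocCellKit.evalL k (G c)}))
    (hσ : ∀ q : MvPolynomial (Fin 5) k,
        σ (reesChartBase (Ideal.Quotient.mk (Ideal.span {f}) (monomial (chartM 5 AL2 CL 327 c) (1 : k))) (mk_vertex_mem k f c)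
          (Ideal.Quotient.mk (Ideal.span {f}) q)) =
          Ideal.Quotient.mk (Ideal.span {KLocCellKit.evalL k (G c)}) (aeval (fun j : Fin 5 => ∏ i : Fin 5, (X i : MvPolynomial (Fin 5) k) ^ Vq c i j) q))
    (q₀ : PrimeSpectrum (HomogeneousLocalization.Away
        (reesGrading (Ideal.span ((fun e : Fin 5 →₀ ℕ => Ideal.Quotient.mk (Ideal.span {f}) (monomial e (1 : k))) '' (genSet 5 AL2 : Set (Fin 5 →₀ ℕ)))))
        (reesT (Ideal.Quotient.mk (Ideal.span {f}) (monomial (chartM 5 AL2 CL 327 c) (1 : k))) (mk_vertex_mem k f c))))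
    (hover : Ideal.span (Set.range fun j : Fin 5 => Ideal.Quotient.mk (Ideal.span {f}) (X j)) ≤
      ((affineBlowup.π _).base ((affineBlowup.chartι (Ideal.Quotient.mk (Ideal.span {f}) (monomial (chartM 5 AL2 CL 327 c) (1 : k))) (mk_vertex_mem k f c)).base q₀)).asIdeal) :
    ∀ j ∈ (Finset.univ : Finset (Fin 5)), Ideal.Quotient.mk (Ideal.span {KLocCellKit.evalL k (G c)})
      (aeval (fun j : Fin 5 => ∏ i : Fin 5, (X i : MvPolynomial (Fin 5) k) ^ Vq c i j) (X j : MvPolynomial (Fin 5) k)) ∈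
      q₀.asIdeal.map (σ : _ →+* MvPolynomial (Fin 5) k ⧸ Ideal.span {KLocCellKit.evalL k (G c)}) := by
  intro j _
  rw [comap_asIdeal_π_chartι] at hover
  have hj : reesChartBase (Ideal.Quotient.mk (Ideal.span {f}) (monomial (chartM 5 AL2 CL 327 c) (1 : k))) (mk_vertex_mem k f c)
      (Ideal.Quotient.mk (Ideal.span {f}) (X j)) ∈ q₀.asIdeal :=
    Ideal.mem_comap.mp (hover (Ideal.subset_span ⟨j, rfl⟩))
  rw [← hσ (X j)]
  exact Ideal.mem_map_of_mem _ hj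

end BedD

end Summit.ResolutionOfSingularities.ResolutionOfSingularities.Theorems.FInjectiveMacaulayfication.FDStorey1Charts

end
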